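import Summits.ResolutionOfSingularities.ResolutionOfSingularities.Theorems.MarkedTransferCampaignW31UscModuloHasseStable
import Literature.AlgebraicGeometry.Hironaka2017.Proofs.S04CharAlgebra.U19L30
import HarnessLib

/-!
# [OURS · L1 W3.1] The u.s.c. rung of slot W3.1 MODULO TH. 4.1 AND §4.1 (2) (graded reading): composition of the slot chain
# (`…UscModuloHasseStable`, `…UscFiniteDegree`, `…EdgeHilbDictionary`, `…EdgeHilbLscProof`) with the discharge lane's
# `U19_4_R2_of : Thm4_1 → Itm4_1_2_R2 → U19_4_R2` (Proofs/S04CharAlgebra/U19L30.lean)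

Cell `res-hironaka` (run/shared/lean/pub/res-hironaka/), rung L (rescue) of LADDER-RESOLUTION, slot W3.1 «u.s.c. first»
(positive rung, verdict-free), seat res-L1-s31-pv-1 (hypersurface rung). Host (custody, no new route) = the EXISTING crux
`Theses.MarkedTransfer.HypersurfaceOrderReduction` (stmt-ResolutionOfSingularities-16155, `--supports … --as helper`).

WHAT. The chain of record for slot W3.1 is: (i) `CampaignW31EdgeHilbLsc_holds` (res-L1-s31-pv-2, unconditional) +
finite-degree assembly (res-L1-s31-pv-1, `campaignW31UscInvOneExponentI_of_dictionary`) + (ii) the dictionary from the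
Hasse–Schmidt stability of the edge algebra (res-L1-s31-pv-3, `campaignW31EdgeHilbDictionary_of_U19_4_R2`) — so the slot
statement holds modulo the typed candidate `U19_4_R2` alone (`campaignW31UscInvOneExponentI_of_U19_4_R2`). The HIRONAKA-L
discharge lane has meanwhile reduced `U19_4_R2` to two §4 candidates (res-D-pv-018, `S04CharAlgebra.U19_4_R2_of`, Q-04-038):
Th. 4.1 (`Thm4_1`, p.17 l.20–30: `℘(E)` is the least graded Diff-stable integrally-closed subalgebra containing the
generators — the manuscript's import from its [23]) and §4.1 property (2) in the graded reading (`Itm4_1_2_R2`, p.18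
l.38–44: every homogeneous differential operator of `κ(ξ)[Z]` is induced on initial forms by one of `O_{Z,ξ}`). This file
records the composition BY NAME, so that adjudication (GAP-LEDGER R13) can cite one theorem: the slot statement
`CampaignW31UscInvOneExponentI p`, its hypersurface rung `CampaignW31UscInvHypersurfaceI p` (this seat's named target), the
dictionary `CampaignW31EdgeHilbDictionary p` and the p.30 consequences `CampaignW31InvmaxClosedI p` all FOLLOW FROM
`Thm4_1 ∧ Itm4_1_2_R2` (for every perfect ambient datum and every ideal exponent), both consumed as HYPOTHESES.

HONEST FRAMING. NOTHING here is a statement of H. Hironaka's manuscript *Resolution of singularities in positive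
characteristics* (2017-03-23, [Hironaka2017], lit key `paper:url-3343fd9e678b`) and nothing here asserts that any statement of
that manuscript holds: `Thm4_1` and `Itm4_1_2_R2` are typed CANDIDATES consumed as hypotheses, never asserted (their own
discharge is the discharge lane's Q-04-001 / Q-04-007; the algebraic core of `Itm4_1_2_R2` for Hasse derivatives is
`Theorems/MarkedTransferCampaignW31HasseSymbol.lean`, p479063). Pure composition; AI-produced kernel bookkeeping, weaker than
expert review.

## References (context only; nothing below is a premise)
* H. Hironaka, ms. 2017-03-23, Th. 4.1 p.17 l.20–30; §4.1 (2) p.18 l.38–44; §4.1 (8) p.19 l.27–32; Eq. (34) p.24; §6.2 p.30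
  l.4–8; p.86 l.7–10 — scope only, under adjudication. [Hironaka2017]
-/

noncomputable section

set_option linter.dupNamespace false -- mandated namespace of this single-conjunct summit

namespace Summit.ResolutionOfSingularities.ResolutionOfSingularities.Theorems

open _root_.AlgebraicGeometry
open Literature.AlgebraicGeometry.Hironaka2017
open Literature.AlgebraicGeometry.Hironaka2017.S02Preliminaries
open Literature.AlgebraicGeometry.Hironaka2017.S04CharAlgebra

universe u

/-- Pure composition: `Thm4_1 ∧ Itm4_1_2_R2` at every perfect ambient datum gives `U19_4_R2` there (discharge lane's
`U19_4_R2_of`). [folklore] -/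
theorem CampaignW31.forall_U19_4_R2_of_Thm4_1 (p : ℕ) [Fact p.Prime]
    (h41 : ∀ (K : Type u) [Field K] [CharP K p] [PerfectField K] (A : AmbientDatum p K) (E : IdealExponent A.Z),
      Thm4_1 p A.hom E)
    (h412 : ∀ (K : Type u) [Field K] [CharP K p] [PerfectField K] (A : AmbientDatum p K) (E : IdealExponent A.Z),
      Itm4_1_2_R2 p A.hom E) :
    ∀ (K : Type u) [Field K] [CharP K p] [PerfectField K] (A : AmbientDatum p K) (E : IdealExponent A.Z),
      U19_4_R2 p A.hom E :=
  fun K _ _ _ A E => U19_4_R2_of p A.hom E (h41 K A E) (h412 K A E)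

/-- **[OURS · L1 W3.1] the dictionary (ii) `CampaignW31EdgeHilbDictionary p` modulo Th. 4.1 and §4.1 (2) (graded reading).**
NOT a statement of the manuscript. [folklore] -/
theorem campaignW31EdgeHilbDictionary_of_Thm4_1 (p : ℕ) [Fact p.Prime]
    (h41 : ∀ (K : Type u) [Field K] [CharP K p] [PerfectField K] (A : AmbientDatum p K) (E : IdealExponent A.Z),
      Thm4_1 p A.hom E)
    (h412 : ∀ (K : Type u) [Field K] [CharP K p] [PerfectField K] (A : AmbientDatum p K) (E : IdealExponent A.Z),
      Itm4_1_2_R2 p A.hom E) :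
    CampaignW31EdgeHilbDictionary.{u} p :=
  campaignW31EdgeHilbDictionary_of_U19_4_R2 p (CampaignW31.forall_U19_4_R2_of_Thm4_1 p h41 h412)

/-- **[OURS · L1 W3.1] THE SLOT STATEMENT `CampaignW31UscInvOneExponentI p` MODULO TH. 4.1 AND §4.1 (2) (graded reading)**:
upper semicontinuity of `ξ ↦ Inv_ξ(E)` on `Sing(E)_cl` for one standard ideal exponent over a perfect field of characteristic
`p`, from the two typed §4 candidates consumed as hypotheses. Chain: `U19_4_R2_of` (discharge lane) → dictionary (pv-3) →
finite-degree assembly (pv-1) with `CampaignW31EdgeHilbLsc_holds` (pv-2). NOT a statement of the manuscript. [folklore] -/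
theorem campaignW31UscInvOneExponentI_of_Thm4_1 (p : ℕ) [Fact p.Prime]
    (h41 : ∀ (K : Type u) [Field K] [CharP K p] [PerfectField K] (A : AmbientDatum p K) (E : IdealExponent A.Z),
      Thm4_1 p A.hom E)
    (h412 : ∀ (K : Type u) [Field K] [CharP K p] [PerfectField K] (A : AmbientDatum p K) (E : IdealExponent A.Z),
      Itm4_1_2_R2 p A.hom E) :
    CampaignW31UscInvOneExponentI.{u} p :=
  campaignW31UscInvOneExponentI_of_U19_4_R2 p (CampaignW31.forall_U19_4_R2_of_Thm4_1 p h41 h412)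

/-- **[OURS · L1 W3.1] THE HYPERSURFACE RUNG `CampaignW31UscInvHypersurfaceI p` MODULO TH. 4.1 AND §4.1 (2) (graded reading)**
(seat res-L1-s31-pv-1's named target; `J` effective Cartier, the setting of the host crux stmt-16155 and of K3.1's
specimen). NOT a statement of the manuscript. [folklore] -/
theorem campaignW31UscInvHypersurfaceI_of_Thm4_1 (p : ℕ) [Fact p.Prime]
    (h41 : ∀ (K : Type u) [Field K] [CharP K p] [PerfectField K] (A : AmbientDatum p K) (E : IdealExponent A.Z),
      Thm4_1 p A.hom E)
    (h412 : ∀ (K : Type u) [Field K] [CharP K p] [PerfectField K] (A : AmbientDatum p K) (E : IdealExponent A.Z),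
      Itm4_1_2_R2 p A.hom E) :
    CampaignW31UscInvHypersurfaceI.{u} p :=
  campaignW31UscInvHypersurfaceI_of_U19_4_R2 p (CampaignW31.forall_U19_4_R2_of_Thm4_1 p h41 h412)

/-- **[OURS · L1 W3.1] `Inv_max` attained and the `Inv_max`-stratum closed (`CampaignW31InvmaxClosedI p`) MODULO TH. 4.1 AND
§4.1 (2) (graded reading)** — the two p.30 consequences (DOSSIER group-3 §2 R13b). NOT a statement of the manuscript. [folklore] -/
theorem campaignW31InvmaxClosedI_of_Thm4_1 (p : ℕ) [Fact p.Prime]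
    (h41 : ∀ (K : Type u) [Field K] [CharP K p] [PerfectField K] (A : AmbientDatum p K) (E : IdealExponent A.Z),
      Thm4_1 p A.hom E)
    (h412 : ∀ (K : Type u) [Field K] [CharP K p] [PerfectField K] (A : AmbientDatum p K) (E : IdealExponent A.Z),
      Itm4_1_2_R2 p A.hom E) :
    CampaignW31InvmaxClosedI.{u} p :=
  campaignW31InvmaxClosedI_of_U19_4_R2 p (CampaignW31.forall_U19_4_R2_of_Thm4_1 p h41 h412)

/-- **[OURS · L1 W3.1]** parametric form: Th. 4.1 and §4.1 (2) (graded reading) at every prime give the slot statement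
`CampaignW31UscInvOneExponent` at row 005 part b's provenance `CampaignW31.edgeDataProvenance`. NOT a statement of the
manuscript. [folklore] -/
theorem campaignW31UscInvOneExponent_of_Thm4_1
    (h41 : ∀ (p : ℕ) [Fact p.Prime] (K : Type u) [Field K] [CharP K p] [PerfectField K] (A : AmbientDatum p K)
      (E : IdealExponent A.Z), Thm4_1 p A.hom E)
    (h412 : ∀ (p : ℕ) [Fact p.Prime] (K : Type u) [Field K] [CharP K p] [PerfectField K] (A : AmbientDatum p K)
      (E : IdealExponent A.Z), Itm4_1_2_R2 p A.hom E) :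
    CampaignW31UscInvOneExponent.{u} CampaignW31.edgeDataProvenance :=
  campaignW31UscInvOneExponentI_iff.mpr fun p _ => campaignW31UscInvOneExponentI_of_Thm4_1 p (h41 p) (h412 p)

/-- **[OURS · L1 W3.1]** parametric form of the hypersurface rung: Th. 4.1 and §4.1 (2) (graded reading) at every prime give
`CampaignW31UscInvHypersurface` at row 005 part b's provenance. NOT a statement of the manuscript. [folklore] -/
theorem campaignW31UscInvHypersurface_of_Thm4_1
    (h41 : ∀ (p : ℕ) [Fact p.Prime] (K : Type u) [Field K] [CharP K p] [PerfectField K] (A : AmbientDatum p K)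
      (E : IdealExponent A.Z), Thm4_1 p A.hom E)
    (h412 : ∀ (p : ℕ) [Fact p.Prime] (K : Type u) [Field K] [CharP K p] [PerfectField K] (A : AmbientDatum p K)
      (E : IdealExponent A.Z), Itm4_1_2_R2 p A.hom E) :
    CampaignW31UscInvHypersurface.{u} CampaignW31.edgeDataProvenance :=
  campaignW31UscInvHypersurfaceI_iff.mpr fun p _ => campaignW31UscInvHypersurfaceI_of_Thm4_1 p (h41 p) (h412 p)

end Summit.ResolutionOfSingularities.ResolutionOfSingularities.Theorems

end
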